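import Summits.QuantumFields.YangMills.Theorems.BalabanUVNodesN12AtRecord12CB10YZW
import Summits.QuantumFields.YangMills.Theorems.BalabanUVNodesN12ResidWPinnedLayer

/-!
# BalabanUVNodes ∕ N12 AT THE STAGE-12 W-PINNED RECORD — WHAT N12 COSTS IN K1′'s ∃-CURRENCY, WITH THE PROPOSITION-1 CARRIER SUPPLIED: at a record of
# `Node00.IsRecordOfRecord₁₂CB10YZW` (re-)presenting def-T's repaired Stage-12 datum, `Dag.B15_main` holds at every run from the p.176 (R-C2) term provisos on the
# record's OWN pre-𝐑 terms and — NEW — from a Proposition-1 carrier `L P : B15.LFVar` the caller PINS into the [IV] layer (`λ.LF = L`) together with its display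
# `B15.Prop1Printed (L P)`; at `L P := B15Prop1Carrier.lfVarOn ch (I P)` (lit-type-B15's carrier OF RECORD) that display is EXACTLY the conclusion of the N12 s1 seat's
# `B15Prop1CarrierOnFromModel.prop1Printed_lfVarOn_of_model` (sequel of `BalabanUVNodesN12AtRecord12CB10YZW`; Track A, DAG node N12 = [B15, Balaban1989LargeFieldI]
# CMP 122 (1989) 175; cluster K1′ `StabilityBAtRecordR12e` = stmt-QuantumFields-19790 (rev 13); seat `pub-ymgap-dag-n12-d` g2 (R134 s2), 2026-08-26; count-neutral, NOT a discharge)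

HONEST FRAMING.  Count-neutral kernel BOOKKEEPING; nothing of Bałaban's asserted; N12 NOT discharged.  The route's K1 (rev 6 ∕ 7) is an ∃-form over def-T's
`IsRecordOfRecord₁₁C F 2` — UNINHABITED in the kernel (`Record12.not_isRecordOfRecord₁₁C`), so this seat's Stage-11 census `BalabanUVNodesN12AtRecord11ExistsCurrency`
(p452875) has become vacuous; rev 13 re-keys K1′ (stmt-QuantumFields-19790, θ-keyed) over the REPAIRED `Record12` (`Provisos₁₂`: no all-runs radii field, `bg` window-guarded; 𝐓-weights pinned per run).
THIS FILE is the Stage-12 census, sharpened by the N12 s1 ∕ s3 seats' landed pins; the Stage-9 generic letters it consumes (`exists_residW_pinLF_printedDisplays`,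
`exists_residW_pinLF_wDisplays₁₀_of_provisos₁₀`, `prop1Printed_emptyCarrier`, `wDisplays₁₀_pinAll_of_deg`, the census `prop1Printed_lfVarOn_of_isEmpty`) are this seat's
`BalabanUVNodesN12ResidWPinnedLayer` (§1 there: a layer with `kSel = k`, `LF = L` at which the THREE OTHER printed displays hold DEGENERATELY — g0's located species with the
carrier slot handed to the caller; §2 there: the layer with ALL THREE letters pinned and its displays on every run).
* §2 (Stage 12) `exists_world₁₂CB10YZW_b15_main_pinLF_of_mass` — every admissible Stage-12 parameter with its provisos, any floor ∕ operator layer ∕ [B11] layer, window,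
  step selector `k` AND PROPOSITION-1 CARRIER FAMILY `L` WITH ITS DISPLAYS present a ₁₂CB10YZW record (datum `datumOfRecord₁₂ θ h`) at a world whose [IV] layer HAS
  `kSel = k`, `LF = L` and where `Dag.B15_main` holds at EVERY run (from positive mass at the selected step, + the three provisos on the `K = 0` tori);
  `exists_world₁₂CB10YZW_b15_main_of_mass` — the degenerate corner `L :=` the EMPTY carrier (g0's statement, 11 ↦ 12);
  `exists_rebind₁₂CB10YZW_b9_b15_main_pinLF_of_isRecordOfRecord₁₂C_of_mass` — every ₁₂C record `(D, w)` is RE-PRESENTED (SAME `D`, construction, window, block size) by a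
  ₁₂CB10YZW world whose [IV] layer carries the caller's `L`, at which N06 (the N06 seat's zero operator layer) AND N12 hold at every run; and its degenerate corner
  `exists_rebind₁₂CB10YZW_b9_b15_main_of_isRecordOfRecord₁₂C_of_mass`.
* §3 THE CARRIER OF RECORD — `exists_world₁₂CB10YZW_b15_main_lfVarOn_of_mass` ∕ `exists_rebind₁₂CB10YZW_b9_b15_main_lfVarOn_of_isRecordOfRecord₁₂C_of_mass`: §2 at
  `L P := lfVarOn ch (I P)` for an exponential chart `ch` of `SU(N)` and per-run families `I P : ι P → InstOn (F.P P.K) (SU N)` of print's instances (`Λ`, `Z`, `k`, `V_k`,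
  the function (1.77) with its domain); the display `hP1 P : Prop1Printed (lfVarOn ch (I P))` is, letter for letter, the CONCLUSION of
  `B15Prop1CarrierOnFromModel.prop1Printed_lfVarOn_of_model ch (I P) …` (p457808: from the p.359 model letters (m1)–(m5), (x) and the object dictionary (c1)–(c4)) — one
  application per run closes it (census `N12ResidWPinnedLayer.prop1Printed_lfVarOn_of_isEmpty`: at an EMPTY instance family the display is again vacuous, so the pin is
  contentful exactly at inhabited families of print's instances — NODE 00 has no `LFOfRecord` yet, n12-c's located obligation list).
* §4 ALL THREE LETTERS PINNED — `exists_world₁₂CB10YZW_b15_main_pinAll_of_mass` ∕ `exists_rebind₁₂CB10YZW_b9_b15_main_pinAll_of_isRecordOfRecord₁₂C_of_mass`: the layer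
  `(λ₀.pinRPrime θ₉).pinD189 θ₉ σ` of the N12 s3 seat's data transformers (`B15Claim189PinAtRecord` p456430 ∕ `B15RPrime1100AtRecord` p452570…v1.2) with `LF := L`: its
  (1.89) letters ARE `D189OfRecord θ₉ P (σ P)` (r11's print's-instance setting at def-R's background of record; the (1.89) SITUATION `σ P : Node00.Sit189` residual), its
  (1.100) data IS the 𝐑-step's reading — so (1.102) is RETIRED (a theorem: `wDisplays₁₀_of_rPrimePin_deg`) and `Dag.B15_main` at every run costs exactly: positive mass, the
  support provisos on runs whose step is not below `K`, Proposition 1 at `L`, (1.80) at `σ.dev0` with the record's `ε_k ∕ η_k`, (1.89) as one display at the letters of record;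
  CENSUS `exists_world₁₂CB10YZW_b15_main_pinAll_junkSit_of_mass` — at the junk situation of `N12ResidWPinnedLayer.exists_sit189_not_new189` ((1.82) letter `χ′ :≡ ⊥`) the same
  triply pinned record needs NEITHER (1.80) NOR (1.89): the (1.89) situation must be the run's own (no `Sit189OfRecord` in the tree); and the ∀-form closer at triply pinned
  records `s_N12_of_refines₁₂CB10YZW_of_pinAll_deg` (n12-e's `…of_pinnedLayers_deg` one storey up).
WHAT THIS LOCATES (typing strength, count-neutral, NOT a second gap): in K1′'s ∃-currency, at the [IV] layer whose three letters are pinned as above, the N12 conjunct of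
`DagBinding.Nodes` costs POSITIVE MASS of the record's pre-𝐑 terms (NODE 00: positivity of `𝐓_k e^{A_k}`, non-nullity of `χ_k(Ω_k)` — neither proved nor assumed), [IV]
Proposition 1 at the carrier the assembly chooses (the tree HAS it at `lfVarOn ch I` modulo n12-c's displayed letters (m1)–(m5), (x), (c1)–(c4)), and [IV] (1.80) + (1.89)
at the N12 s3 seat's letters of record (typed; (1.89)'s leaves `L91h ∕ L95 ∕ L91 ∕ L97` and the deviations of (1.90) ∕ (1.97) ∕ `U₀^{ū₀}` stay letters — n12-e's located (iv));
(1.102) costs nothing.  One finite four-torus programme at fixed `ε`; nothing continuum ∕ ℝ⁴ ∕ OS ∕ mass gap ∕ Clay.  0 `sorry`, 0 `def`, standard axioms.  Filed `--supports`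
K1′ `StabilityBAtRecordR12e` (stmt-QuantumFields-19790, rev 13).
Sources: [Balaban1989LargeFieldI] (0.2)–(0.6) p.176, Prop. 1 (1.77)–(1.78) p.194, (1.80) p.195, (1.89) p.198, (1.99)–(1.102) pp.200–201; [Balaban1989LargeFieldII] Thm 1 +
(0.1) pp.355–356, pp.358–359 (proof of Prop. 1 [IV]); [Balaban1988Convergent] (2.12) p.256, (2.16)–(2.18) p.257, (2.21) p.258, (3.25) p.270.
-/

noncomputable section

open MeasureTheory

namespace Summit.QuantumFields.YangMills.BalabanUVNodes.N12AtRecord12ExistsCurrency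

open Literature.MathematicalPhysics.QuantumFieldTheory.Balaban1983to89
open Literature.MathematicalPhysics.QuantumFieldTheory.Balaban1983to89.T4Continuum (T4Family FiniteEpsData)
open Literature.MathematicalPhysics.QuantumFieldTheory.Balaban1983to89.DagBinding (WorldP leavesP PrintedCarriers15 B15Leaf B9LeafX B11Leaf)
open Literature.MathematicalPhysics.QuantumFieldTheory.Balaban1983to89.Node00
open B15Claim189Assembly (Setting189 new189 chiPP dom)
open B15Sect1Statements (RPrimeData Normalization1102 rPrime1100)
open B15 (LFVar Prop1Printed Ineq180)
open B15.BasicStep (Claim189)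
open B8Eq17ClassAkV1 (plaqsOf)
open B16Sect1Backgrounds (ExpChart)
open B15Prop1Carrier (InstOn lfVarOn)
open B15Claim189PinAtRecord (D189OfRecord)
open YMDAG.UVSplit (RecordPred Datum AtRecord S_N12)
open Summit.QuantumFields.YangMills.BalabanUVNodes.N12AtRecord12CB10YZW (b15_main_of_up_view₁₂B10YZW_of_displays s_N12_of_refines₁₂CB10YZW_of_displays)
open Summit.QuantumFields.YangMills.BalabanUVNodes.N12ResidWPinnedLayer
  (exists_residW_pinLF_printedDisplays exists_residW_pinLF_wDisplays₁₀_of_provisos₁₀ prop1Printed_emptyCarrier wDisplays₁₀_pinAll_of_deg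
    exists_sit189_not_new189 wDisplays₁₀_pinAll_of_deg_of_not_new189)
open Summit.QuantumFields.YangMills.BalabanUVNodes.N06AtRecord9CB10Y (exists_junkOps_b9LeafX_Y9OfRecord)

variable {N : ℕ} [NeZero N]

/-! ## §2 WHAT N12 COSTS IN K1′'s ∃-CURRENCY: a ₁₂CB10YZW record with `Dag.B15_main` at every run from POSITIVE MASS below `K` and the PINNED carrier's displays -/

section Currency
variable {F : T4Family}

/-- **A STAGE-12 RECORD WITH N12 AT EVERY RUN AND A PRESCRIBED PROPOSITION-1 CARRIER IN ITS [IV] LAYER.**  Every admissible Stage-12 parameter with its provisos, ANY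
floor ∕ operator layer ∕ [B11] layer, any window `0 < γw ≤ θ.γ`, any step selector `k` and any carrier family `L` WITH ITS DISPLAYS `Prop1Printed (L P)` present a record
of `IsRecordOfRecord₁₂CB10YZW` (datum `datumOfRecord₁₂ θ h`) at a world whose [IV] layer `λ` has `λ.kSel = k`, `λ.LF = L`, where `Dag.B15_main` HOLDS AT EVERY RUN, provided:
(`hmass`) at every run every pre-𝐑 term of `Tstep rep_{k P}` of the tower of record has POSITIVE MASS, and (`hdeg`) on the runs where the selected step is NOT below `K`
the three remaining term provisos are supplied (below `K` they are the record's own).  (1.80) ∕ (1.89) ∕ (1.102) are NOT consumed (degenerate `D189 ∕ D1100`); Proposition 1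
IS, at the carrier the caller chooses (`N12AtRecord12CB10YZW.b15_main_of_up_view₁₂B10YZW_of_displays` BY NAME).  LOCATED; NOT a discharge.
[cite: Balaban1989LargeFieldI, (0.2)–(0.6) p.176, Prop. 1 (1.78) p.194; Balaban1989LargeFieldII, Thm 1 + (0.1) pp.355–356 (bookkeeping: the ∃-currency with the Prop-1 carrier pinned)] -/
theorem exists_world₁₂CB10YZW_b15_main_pinLF_of_mass (θ : Stage12Params F N) (h : θ.Provisos₁₂ F N) (hθ : θ.Admissible F N) (Mstar : ℕ)
    (ops : OpsY N θ.toStage3Params Mstar) (ζ : ResidZ F N) {γw : ℝ} (hγw : 0 < γw ∧ γw ≤ θ.γ) (k : B12.RunParams → ℕ) (L : B12.RunParams → LFVar)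
    (hL : ∀ P, Prop1Printed (L P))
    (hmass : ∀ (P : B12.RunParams) s,
      0 < ∫ V, rterm (reprTOfRecord₁₀ F N θ.toStage9Params P (k P)) s V ∂(fieldMeasure (F.P P.K) (k P + 1) (SU N)))
    (hdeg : ∀ P : B12.RunParams, P.K ≤ k P →
      (∀ s, Measurable (rterm (reprTOfRecord₁₀ F N θ.toStage9Params P (k P)) s)) ∧
      (∀ s V, 0 ≤ rterm (reprTOfRecord₁₀ F N θ.toStage9Params P (k P)) s V) ∧
      ∃ Cρ : ℝ, ∀ s V, rterm (reprTOfRecord₁₀ F N θ.toStage9Params P (k P)) s V ≤ Cρ) :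
    ∃ (lamW : ResidW F N) (w : WorldP), lamW.kSel = k ∧ lamW.LF = L ∧ IsRecordOfRecord₁₂CB10YZW F N (datumOfRecord₁₂ F N θ h) w ∧ w.γ = γw ∧
      (∀ P, w.up P = upOfRecord₅C F N (θ.view₁₂B10YZW F N Mstar ops ζ lamW) P) ∧ ∀ P : B12.RunParams, Dag.B15_main (leavesP w P) := by
  obtain ⟨lamW, hk, hLF, hd⟩ := exists_residW_pinLF_wDisplays₁₀_of_provisos₁₀ θ.toStage9Params h.base k L hL
  obtain ⟨w₀⟩ := nonempty_worldP
  refine ⟨lamW, { w₀ with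
      C := (datumOfRecord₁₂ F N θ h).C, γ := γw, L := (θ.L : ℝ), one_lt_L := by exact_mod_cast θ.hL.2,
      up := fun P => upOfRecord₅C F N (θ.view₁₂B10YZW F N Mstar ops ζ lamW) P }, hk, hLF,
    ⟨θ, h, Mstar, ops, ζ, lamW, hθ, rfl, rfl, hγw, rfl, fun _ => rfl⟩, rfl, fun _ => rfl, fun P => ?_⟩
  refine b15_main_of_up_view₁₂B10YZW_of_displays θ Mstar ops ζ lamW rfl ?_
  rcases lt_or_ge (k P) P.K with hK | hK
  · exact (hd P).2 hK (hmass P)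
  · obtain ⟨hm, h0, hC⟩ := hdeg P hK
    exact (hd P).1 hm h0 hC (hmass P)

/-- **A STAGE-12 RECORD WITH N12 AT EVERY RUN, FROM POSITIVE MASS ALONE (below `K`)** — the degenerate corner of `exists_world₁₂CB10YZW_b15_main_pinLF_of_mass` at the EMPTY
Proposition-1 carrier: NOTHING of [IV]'s Prop. 1 ∕ (1.80) ∕ (1.89) ∕ (1.102) is consumed (this seat's Stage-11 statement `exists_world₁₁CB10YZW_b15_main_of_mass`, 11 ↦ 12 —
now over an inhabitable record predicate).  LOCATED; NOT a discharge. [cite: Balaban1989LargeFieldI, (0.2)–(0.6) p.176, Prop. 1 p.194; Balaban1989LargeFieldII, Thm 1 + (0.1) pp.355–356 (bookkeeping: the ∃-currency at residual letters)] -/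
theorem exists_world₁₂CB10YZW_b15_main_of_mass (θ : Stage12Params F N) (h : θ.Provisos₁₂ F N) (hθ : θ.Admissible F N) (Mstar : ℕ)
    (ops : OpsY N θ.toStage3Params Mstar) (ζ : ResidZ F N) {γw : ℝ} (hγw : 0 < γw ∧ γw ≤ θ.γ) (k : B12.RunParams → ℕ)
    (hmass : ∀ (P : B12.RunParams) s,
      0 < ∫ V, rterm (reprTOfRecord₁₀ F N θ.toStage9Params P (k P)) s V ∂(fieldMeasure (F.P P.K) (k P + 1) (SU N)))
    (hdeg : ∀ P : B12.RunParams, P.K ≤ k P →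
      (∀ s, Measurable (rterm (reprTOfRecord₁₀ F N θ.toStage9Params P (k P)) s)) ∧
      (∀ s V, 0 ≤ rterm (reprTOfRecord₁₀ F N θ.toStage9Params P (k P)) s V) ∧
      ∃ Cρ : ℝ, ∀ s V, rterm (reprTOfRecord₁₀ F N θ.toStage9Params P (k P)) s V ≤ Cρ) :
    ∃ (lamW : ResidW F N) (w : WorldP), lamW.kSel = k ∧ IsRecordOfRecord₁₂CB10YZW F N (datumOfRecord₁₂ F N θ h) w ∧ w.γ = γw ∧
      (∀ P, w.up P = upOfRecord₅C F N (θ.view₁₂B10YZW F N Mstar ops ζ lamW) P) ∧ ∀ P : B12.RunParams, Dag.B15_main (leavesP w P) := by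
  obtain ⟨lamW, w, hk, -, hrec, hγ, hup, hN⟩ := exists_world₁₂CB10YZW_b15_main_pinLF_of_mass θ h hθ Mstar ops ζ hγw k _
    (fun _ => prop1Printed_emptyCarrier) hmass hdeg
  exact ⟨lamW, w, hk, hrec, hγ, hup, hN⟩

variable {D : Datum F N} {w : WorldP}

/-- **EVERY ₁₂C RECORD IS RE-PRESENTED BY A ₁₂CB10YZW WORLD WITH N06 AND N12 AT EVERY RUN AND A PRESCRIBED PROPOSITION-1 CARRIER IN ITS [IV] LAYER, given positive
mass keyed to the presenting parameter** — SAME datum `D`, same construction, window and block size; floor `0`, the N06 seat's ZERO operator layer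
(`N06AtRecord9CB10Y.exists_junkOps_b9LeafX_Y9OfRecord`), any [B11] layer, the §1 layer with `kSel = k`, `LF = L`.  So in the ∃-form K1′ the N06 ∧ N12 conjuncts of
`DagBinding.Nodes` cost EXACTLY `hmass` (+ `hdeg` on the `K = 0` tori) and the Proposition-1 displays of the carrier the assembly pins: for every `(θ, h)` presenting `(D, w)`
as a ₁₂C record, positive mass of the pre-𝐑 terms of `Tstep rep_{k P}` — NODE 00's business; LOCATED, count-neutral; NOT-A-DISCHARGE of N06 or N12.
[cite: Balaban1989LargeFieldI, (0.2)–(0.6) p.176, Prop. 1 (1.78) p.194; Balaban1985BackgroundPropagators, Thms 3.1–3.15 pp.397–432; Balaban1989LargeFieldII, Thm 1 + (0.1) pp.355–356 (bookkeeping)] -/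
theorem exists_rebind₁₂CB10YZW_b9_b15_main_pinLF_of_isRecordOfRecord₁₂C_of_mass (hrec : IsRecordOfRecord₁₂C F N D w) (k : B12.RunParams → ℕ)
    (L : B12.RunParams → LFVar) (hL : ∀ P, Prop1Printed (L P))
    (hmass : ∀ (θ : Stage12Params F N) (hP : θ.Provisos₁₂ F N), θ.Admissible F N → D = datumOfRecord₁₂ F N θ hP →
      (∀ P, w.up P = upOfRecord₅C F N (θ.toStage5₁₂ F N) P) →
        (∀ (P : B12.RunParams) s,
          0 < ∫ V, rterm (reprTOfRecord₁₀ F N θ.toStage9Params P (k P)) s V ∂(fieldMeasure (F.P P.K) (k P + 1) (SU N))) ∧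
        (∀ P : B12.RunParams, P.K ≤ k P →
          (∀ s, Measurable (rterm (reprTOfRecord₁₀ F N θ.toStage9Params P (k P)) s)) ∧
          (∀ s V, 0 ≤ rterm (reprTOfRecord₁₀ F N θ.toStage9Params P (k P)) s V) ∧
          ∃ Cρ : ℝ, ∀ s V, rterm (reprTOfRecord₁₀ F N θ.toStage9Params P (k P)) s V ≤ Cρ)) :
    ∃ w' : WorldP, IsRecordOfRecord₁₂CB10YZW F N D w' ∧ w'.C = w.C ∧ w'.γ = w.γ ∧ w'.L = w.L ∧
      (∃ (θ : Stage12Params F N) (Mstar : ℕ) (ops : OpsY N θ.toStage3Params Mstar) (ζ : ResidZ F N) (lamW : ResidW F N),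
        lamW.kSel = k ∧ lamW.LF = L ∧ ∀ P, w'.up P = upOfRecord₅C F N (θ.view₁₂B10YZW F N Mstar ops ζ lamW) P) ∧
      ∀ P : B12.RunParams, Dag.B9_main (leavesP w' P) ∧ Dag.B15_main (leavesP w' P) := by
  obtain ⟨θ, hP, hθ, hD, hCw, hγ, hwL, hup⟩ := hrec
  obtain ⟨hm', hdeg⟩ := hmass θ hP hθ hD hup
  obtain ⟨lamW, hk, hLF, hd⟩ := exists_residW_pinLF_wDisplays₁₀_of_provisos₁₀ θ.toStage9Params hP.base k L hL
  obtain ⟨ops, -, hleaf⟩ := exists_junkOps_b9LeafX_Y9OfRecord (N := N) θ.toStage3Params hθ.1.1.1.1.1 0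
  obtain ⟨ζ⟩ := nonempty_residZ F N
  refine ⟨{ w with up := fun P => upOfRecord₅C F N (θ.view₁₂B10YZW F N 0 ops ζ lamW) P },
    ⟨θ, hP, 0, ops, ζ, lamW, hθ, hD, hCw, hγ, hwL, fun _ => rfl⟩, rfl, rfl, rfl, ⟨θ, 0, ops, ζ, lamW, hk, hLF, fun _ => rfl⟩, fun P => ⟨?_, ?_⟩⟩
  · intro _ _ _ _
    show (upOfRecord₅C F N (θ.view₁₂B10YZW F N 0 ops ζ lamW) P).b9
    exact (upOfRecord₅C_view₁₂B10YZW_leaves F N θ 0 ops ζ lamW P).2.1.2 hleaf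
  · refine b15_main_of_up_view₁₂B10YZW_of_displays θ 0 ops ζ lamW rfl ?_
    rcases lt_or_ge (k P) P.K with hK | hK
    · exact (hd P).2 hK (hm' P)
    · obtain ⟨hm, h0, hC⟩ := hdeg P hK
      exact (hd P).1 hm h0 hC (hm' P)

/-- **EVERY ₁₂C RECORD IS RE-PRESENTED BY A ₁₂CB10YZW WORLD WITH N06 AND N12 AT EVERY RUN, given positive mass keyed to the presenting parameter** — the degenerate
corner of the previous theorem at the EMPTY Proposition-1 carrier (this seat's Stage-11 statement, 11 ↦ 12): NOTHING of [IV]'s printed estimates consumed.  LOCATED;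
NOT-A-DISCHARGE. [cite: Balaban1989LargeFieldI, (0.2)–(0.6) p.176, Prop. 1 p.194; Balaban1985BackgroundPropagators, Thms 3.1–3.15 pp.397–432; Balaban1989LargeFieldII, Thm 1 + (0.1) pp.355–356 (bookkeeping)] -/
theorem exists_rebind₁₂CB10YZW_b9_b15_main_of_isRecordOfRecord₁₂C_of_mass (hrec : IsRecordOfRecord₁₂C F N D w) (k : B12.RunParams → ℕ)
    (hmass : ∀ (θ : Stage12Params F N) (hP : θ.Provisos₁₂ F N), θ.Admissible F N → D = datumOfRecord₁₂ F N θ hP →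
      (∀ P, w.up P = upOfRecord₅C F N (θ.toStage5₁₂ F N) P) →
        (∀ (P : B12.RunParams) s,
          0 < ∫ V, rterm (reprTOfRecord₁₀ F N θ.toStage9Params P (k P)) s V ∂(fieldMeasure (F.P P.K) (k P + 1) (SU N))) ∧
        (∀ P : B12.RunParams, P.K ≤ k P →
          (∀ s, Measurable (rterm (reprTOfRecord₁₀ F N θ.toStage9Params P (k P)) s)) ∧
          (∀ s V, 0 ≤ rterm (reprTOfRecord₁₀ F N θ.toStage9Params P (k P)) s V) ∧
          ∃ Cρ : ℝ, ∀ s V, rterm (reprTOfRecord₁₀ F N θ.toStage9Params P (k P)) s V ≤ Cρ)) :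
    ∃ w' : WorldP, IsRecordOfRecord₁₂CB10YZW F N D w' ∧ w'.C = w.C ∧ w'.γ = w.γ ∧ w'.L = w.L ∧
      ∀ P : B12.RunParams, Dag.B9_main (leavesP w' P) ∧ Dag.B15_main (leavesP w' P) := by
  obtain ⟨w', hrec', hC, hγ, hL, -, hN⟩ := exists_rebind₁₂CB10YZW_b9_b15_main_pinLF_of_isRecordOfRecord₁₂C_of_mass hrec k _
    (fun _ => prop1Printed_emptyCarrier) hmass
  exact ⟨w', hrec', hC, hγ, hL, hN⟩

end Currency

/-! ## §3 THE CARRIER OF RECORD — the Proposition-1 slot of the [IV] layer at lit-type-B15's `lfVarOn ch (I P)`; the display is the N12 s1 seat's theorem's conclusion -/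

section CarrierOfRecord
variable {F : T4Family} {𝔤 : Type*} [AddCommGroup 𝔤] [Module ℝ 𝔤]

/-- **A STAGE-12 RECORD WITH N12 AT EVERY RUN WHOSE [IV] LAYER CARRIES THE PROPOSITION-1 CARRIER OF RECORD `lfVarOn ch (I P)`** — `exists_world₁₂CB10YZW_b15_main_pinLF_of_mass`
at `L P := lfVarOn ch (I P)`: an exponential chart `ch` of `SU(N)` ([LF-II] (1.19)) and, per run, a family `I P : ι P → InstOn (F.P P.K) (SU N)` of print's instances
(`Λ`, `Z`, the step, the datum `V_k`, the function (1.77) with its domain).  THE DISPLAY `hP1 P : Prop1Printed (lfVarOn ch (I P))` IS, LETTER FOR LETTER, THE CONCLUSION of the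
N12 s1 seat's `B15Prop1CarrierOnFromModel.prop1Printed_lfVarOn_of_model ch (I P) …` (from the p.359 model letters (m1)–(m5), (x) and the object dictionary (c1)–(c4)) — one
application per run supplies it; (1.80) ∕ (1.89) ∕ (1.102) stay at degenerate letters.  LOCATED; NOT a discharge. [cite: Balaban1989LargeFieldI, (0.2)–(0.6) p.176, Prop. 1 (1.77)–(1.78) p.194; Balaban1989LargeFieldII, pp.358–359 (proof of Prop. 1 [IV]), Thm 1 + (0.1) pp.355–356 (bookkeeping: the ∃-currency at the carrier of record)] -/
theorem exists_world₁₂CB10YZW_b15_main_lfVarOn_of_mass (θ : Stage12Params F N) (h : θ.Provisos₁₂ F N) (hθ : θ.Admissible F N) (Mstar : ℕ)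
    (ops : OpsY N θ.toStage3Params Mstar) (ζ : ResidZ F N) {γw : ℝ} (hγw : 0 < γw ∧ γw ≤ θ.γ) (k : B12.RunParams → ℕ)
    (ch : ExpChart (SU N) 𝔤) {ι : B12.RunParams → Type} (I : ∀ P : B12.RunParams, ι P → InstOn (F.P P.K) (SU N))
    (hP1 : ∀ P, Prop1Printed (lfVarOn ch (I P)))
    (hmass : ∀ (P : B12.RunParams) s,
      0 < ∫ V, rterm (reprTOfRecord₁₀ F N θ.toStage9Params P (k P)) s V ∂(fieldMeasure (F.P P.K) (k P + 1) (SU N)))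
    (hdeg : ∀ P : B12.RunParams, P.K ≤ k P →
      (∀ s, Measurable (rterm (reprTOfRecord₁₀ F N θ.toStage9Params P (k P)) s)) ∧
      (∀ s V, 0 ≤ rterm (reprTOfRecord₁₀ F N θ.toStage9Params P (k P)) s V) ∧
      ∃ Cρ : ℝ, ∀ s V, rterm (reprTOfRecord₁₀ F N θ.toStage9Params P (k P)) s V ≤ Cρ) :
    ∃ (lamW : ResidW F N) (w : WorldP), lamW.kSel = k ∧ (lamW.LF = fun P => lfVarOn ch (I P)) ∧
      IsRecordOfRecord₁₂CB10YZW F N (datumOfRecord₁₂ F N θ h) w ∧ w.γ = γw ∧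
      (∀ P, w.up P = upOfRecord₅C F N (θ.view₁₂B10YZW F N Mstar ops ζ lamW) P) ∧ ∀ P : B12.RunParams, Dag.B15_main (leavesP w P) :=
  exists_world₁₂CB10YZW_b15_main_pinLF_of_mass θ h hθ Mstar ops ζ hγw k (fun P => lfVarOn ch (I P)) hP1 hmass hdeg

variable {D : Datum F N} {w : WorldP}

/-- **EVERY ₁₂C RECORD IS RE-PRESENTED BY A ₁₂CB10YZW WORLD WITH N06 AND N12 AT EVERY RUN WHOSE [IV] LAYER CARRIES THE PROPOSITION-1 CARRIER OF RECORD `lfVarOn ch (I P)`**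
— `exists_rebind₁₂CB10YZW_b9_b15_main_pinLF_of_isRecordOfRecord₁₂C_of_mass` at `L P := lfVarOn ch (I P)`; the display `hP1` is the conclusion of the N12 s1 seat's
`prop1Printed_lfVarOn_of_model ch (I P) …`, one application per run.  The shape the K1′ ∃-assembly consumes for its N06 ∧ N12 conjuncts once it pins the [IV] layer's
Proposition-1 carrier to print's; LOCATED; NOT-A-DISCHARGE. [cite: Balaban1989LargeFieldI, (0.2)–(0.6) p.176, Prop. 1 (1.77)–(1.78) p.194; Balaban1989LargeFieldII, pp.358–359, Thm 1 + (0.1) pp.355–356; Balaban1985BackgroundPropagators, Thms 3.1–3.15 pp.397–432 (bookkeeping)] -/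
theorem exists_rebind₁₂CB10YZW_b9_b15_main_lfVarOn_of_isRecordOfRecord₁₂C_of_mass (hrec : IsRecordOfRecord₁₂C F N D w) (k : B12.RunParams → ℕ)
    (ch : ExpChart (SU N) 𝔤) {ι : B12.RunParams → Type} (I : ∀ P : B12.RunParams, ι P → InstOn (F.P P.K) (SU N))
    (hP1 : ∀ P, Prop1Printed (lfVarOn ch (I P)))
    (hmass : ∀ (θ : Stage12Params F N) (hP : θ.Provisos₁₂ F N), θ.Admissible F N → D = datumOfRecord₁₂ F N θ hP →
      (∀ P, w.up P = upOfRecord₅C F N (θ.toStage5₁₂ F N) P) →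
        (∀ (P : B12.RunParams) s,
          0 < ∫ V, rterm (reprTOfRecord₁₀ F N θ.toStage9Params P (k P)) s V ∂(fieldMeasure (F.P P.K) (k P + 1) (SU N))) ∧
        (∀ P : B12.RunParams, P.K ≤ k P →
          (∀ s, Measurable (rterm (reprTOfRecord₁₀ F N θ.toStage9Params P (k P)) s)) ∧
          (∀ s V, 0 ≤ rterm (reprTOfRecord₁₀ F N θ.toStage9Params P (k P)) s V) ∧
          ∃ Cρ : ℝ, ∀ s V, rterm (reprTOfRecord₁₀ F N θ.toStage9Params P (k P)) s V ≤ Cρ)) :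
    ∃ w' : WorldP, IsRecordOfRecord₁₂CB10YZW F N D w' ∧ w'.C = w.C ∧ w'.γ = w.γ ∧ w'.L = w.L ∧
      (∃ (θ : Stage12Params F N) (Mstar : ℕ) (ops : OpsY N θ.toStage3Params Mstar) (ζ : ResidZ F N) (lamW : ResidW F N),
        lamW.kSel = k ∧ (lamW.LF = fun P => lfVarOn ch (I P)) ∧ ∀ P, w'.up P = upOfRecord₅C F N (θ.view₁₂B10YZW F N Mstar ops ζ lamW) P) ∧
      ∀ P : B12.RunParams, Dag.B9_main (leavesP w' P) ∧ Dag.B15_main (leavesP w' P) :=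
  exists_rebind₁₂CB10YZW_b9_b15_main_pinLF_of_isRecordOfRecord₁₂C_of_mass hrec k (fun P => lfVarOn ch (I P)) hP1 hmass

end CarrierOfRecord

/-! ## §4 THE [IV] LAYER WITH ALL THREE LETTERS PINNED — `LF :=` the caller's carrier, `D189 :=` the N12 s3 seat's letters of record `D189OfRecord θ P (σ P)`,
`D1100 :=` the 𝐑-step's (1.100)-reading (`ResidW.pinRPrime`): (1.102) RETIRED as a theorem, (1.80) ∕ (1.89) read at the record's objects -/

section AllPinned
variable {F : T4Family}

/-- **A STAGE-12 RECORD WITH N12 AT EVERY RUN WHOSE [IV] LAYER HAS ALL THREE LETTERS PINNED** — the knit of the three N12 lineages at ₁₂: the layer is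
`λ := (λ₀.pinRPrime θ₉).pinD189 θ₉ σ` with `λ₀.kSel = k`, `λ₀.LF = L` (`θ₉ := θ.toStage9Params`; the conclusion records `λ.kSel = k`, `λ.LF = L` and that BOTH of the N12 s3
seat's data transformers FIX `λ` — so `λ.D189 P = D189OfRecord θ₉ P (σ P)` (`pinD189_D189`) and `λ.D1100 P` = the 𝐑-step's reading (`pinRPrime_D1100`)): its Proposition-1
carrier IS the caller's `L` (at `lfVarOn ch (I P)`: the N12 s1 seat's theorem supplies `hL`), its (1.89) letters ARE `B15Claim189PinAtRecord.D189OfRecord θ₉ P (σ P)` (r11's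
`setting189Std` READ AT def-R's background of record, the record's `M₁ ∕ ε_j`, the fine lattice, def-R's cube geometry; the per-run (1.89) SITUATION `σ P : Node00.Sit189`
stays residual), its (1.100) data IS the 𝐑-step's reading (`B15RPrime1100AtRecord`: the (1.102) display is a THEOREM — `normalization1102_trhoOfRecord9_of_provisos₁₀` below
`K`, `…_rPrimeDataOfSel` on the support provisos otherwise; `wDisplays₁₀_of_rPrimePin_deg` BY NAME).  What `Dag.B15_main` at every run then COSTS, displayed: positive mass of
the pre-𝐑 terms (`hmass`), the support-form provisos on the runs whose selected step is not below `K` (`hdeg`; below `K` they are the record's own), Proposition 1 at `L`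
(`hL`), (1.80) on the ℍ-domains at the situation's deviation letter `σ.dev0` with the record's `ε_k ∕ η_k` (`h180`), and (1.89) AS ONE DISPLAY at the letters of record (`h189`;
its printed leaves are n12-e's `wDisplays₁₀_pinD189_of_rPrimePin_leaves`).  LOCATED; NOT a discharge. [cite: Balaban1989LargeFieldI, (0.2)–(0.6) p.176, Prop. 1 (1.78) p.194, (1.80) p.195, (1.89) p.198, (1.99)–(1.102) pp.200–201; Balaban1988Convergent, (2.12) p.256, (2.16)–(2.17) p.257, (3.25) p.270; Balaban1989LargeFieldII, Thm 1 + (0.1) pp.355–356 (bookkeeping: the ∃-currency at the pinned letters)] -/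
theorem exists_world₁₂CB10YZW_b15_main_pinAll_of_mass (θ : Stage12Params F N) (h : θ.Provisos₁₂ F N) (hθ : θ.Admissible F N) (Mstar : ℕ)
    (ops : OpsY N θ.toStage3Params Mstar) (ζ : ResidZ F N) {γw : ℝ} (hγw : 0 < γw ∧ γw ≤ θ.γ) (k : B12.RunParams → ℕ) (L : B12.RunParams → LFVar)
    (σ : ∀ P : B12.RunParams, Sit189 F N P.K) (hL : ∀ P, Prop1Printed (L P))
    (hmass : ∀ (P : B12.RunParams) s,
      0 < ∫ V, rterm (repTOfRecord9 F N θ.ν θ.τ9 (EOfRecord₁₀ F N θ.toStage9Params) (wOfRecord₉ F N θ.toStage9Params) θ.ppSel P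
        (gOfRecord₁₀ F N θ.toStage9Params P) (k P)) s V ∂(fieldMeasure (F.P P.K) (k P + 1) (SU N)))
    (hdeg : ∀ P : B12.RunParams, P.K ≤ k P →
      (repDataOfSel (repTOfRecord9 F N θ.ν θ.τ9 (EOfRecord₁₀ F N θ.toStage9Params) (wOfRecord₉ F N θ.toStage9Params) θ.ppSel P
          (gOfRecord₁₀ F N θ.toStage9Params P) (k P))
        (θ.ppSel P (gOfRecord₁₀ F N θ.toStage9Params P) (k P + 1)) (fibOfSeq F θ.ν θ.τ9 P (gOfRecord₁₀ F N θ.toStage9Params P) (k P + 1))).ProvisosSupp)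
    (h180 : ∀ (P : B12.RunParams) U, new189 (D189OfRecord θ.toStage9Params P (σ P)) U → ∀ i, (σ P).h ≤ i → i ≤ (σ P).k →
      ∀ q ∈ plaqsOf (dom (D189OfRecord θ.toStage9Params P (σ P)) i),
        Ineq180 ((σ P).dev0 U.1 q) (epsOfRecord θ.ν (gOfRecord₁₀ F N θ.toStage9Params P) (σ P).k) ((F.P P.K).eta (σ P).k) (σ P).B₃ (σ P).B₅ (σ P).M (σ P).δ
          ((σ P).dist q) (σ P).O1)
    (h189 : ∀ P : B12.RunParams, Claim189 (new189 (D189OfRecord θ.toStage9Params P (σ P))) (chiPP (D189OfRecord θ.toStage9Params P (σ P)))) :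
    ∃ (lamW : ResidW F N) (w : WorldP), lamW.kSel = k ∧ lamW.LF = L ∧
      lamW.pinD189 θ.toStage9Params σ = lamW ∧ lamW.pinRPrime θ.toStage9Params = lamW ∧
      IsRecordOfRecord₁₂CB10YZW F N (datumOfRecord₁₂ F N θ h) w ∧ w.γ = γw ∧
      (∀ P, w.up P = upOfRecord₅C F N (θ.view₁₂B10YZW F N Mstar ops ζ lamW) P) ∧ ∀ P : B12.RunParams, Dag.B15_main (leavesP w P) := by
  obtain ⟨lam, hk, hLF, -⟩ := exists_residW_pinLF_printedDisplays θ.toStage9Params k L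
  subst hk hLF
  obtain ⟨w₀⟩ := nonempty_worldP
  refine ⟨(lam.pinRPrime θ.toStage9Params).pinD189 θ.toStage9Params σ, { w₀ with
      C := (datumOfRecord₁₂ F N θ h).C, γ := γw, L := (θ.L : ℝ), one_lt_L := by exact_mod_cast θ.hL.2,
      up := fun P => upOfRecord₅C F N (θ.view₁₂B10YZW F N Mstar ops ζ ((lam.pinRPrime θ.toStage9Params).pinD189 θ.toStage9Params σ)) P },
    rfl, rfl, rfl, rfl,
    ⟨θ, h, Mstar, ops, ζ, (lam.pinRPrime θ.toStage9Params).pinD189 θ.toStage9Params σ, hθ, rfl, rfl, hγw, rfl, fun _ => rfl⟩, rfl, fun _ => rfl, fun P => ?_⟩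
  refine b15_main_of_up_view₁₂B10YZW_of_displays θ Mstar ops ζ ((lam.pinRPrime θ.toStage9Params).pinD189 θ.toStage9Params σ) rfl ?_
  exact wDisplays₁₀_pinAll_of_deg σ h.base (hdeg P) (hmass P) (hL P) (h180 P) (h189 P)

/-- **CENSUS (A2) — THE SAME RECORD AT A JUNK (1.89) SITUATION: (1.80) and (1.89) cost NOTHING.**  With the situation family of
`N12ResidWPinnedLayer.exists_sit189_not_new189` (the (1.82) letter `χ′ :≡ ⊥` — no configuration carries the new functions) the [IV] layer is STILL triply pinned in the sense
of the previous theorem (`LF := L`, `D189 := D189OfRecord θ₉ P (σ P)`, `D1100 :=` the 𝐑-step's reading), yet `Dag.B15_main` at every run follows from positive mass, the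
degenerate-run support provisos and Proposition 1 at `L` ALONE.  So «all three letters pinned» is not yet «[IV] consumed»: the (1.89) situation must be the run's OWN (NODE 00's
`Sit189OfRecord`, not in the tree).  LOCATED; count-neutral. [cite: Balaban1989LargeFieldI, (0.2)–(0.6) p.176, Prop. 1 (1.78) p.194, (1.80) p.195, (1.89) p.198, (1.82) p.196; Balaban1989LargeFieldII, Thm 1 + (0.1) pp.355–356 (bookkeeping census)] -/
theorem exists_world₁₂CB10YZW_b15_main_pinAll_junkSit_of_mass (θ : Stage12Params F N) (h : θ.Provisos₁₂ F N) (hθ : θ.Admissible F N) (Mstar : ℕ)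
    (ops : OpsY N θ.toStage3Params Mstar) (ζ : ResidZ F N) {γw : ℝ} (hγw : 0 < γw ∧ γw ≤ θ.γ) (k : B12.RunParams → ℕ) (L : B12.RunParams → LFVar)
    (hL : ∀ P, Prop1Printed (L P))
    (hmass : ∀ (P : B12.RunParams) s,
      0 < ∫ V, rterm (repTOfRecord9 F N θ.ν θ.τ9 (EOfRecord₁₀ F N θ.toStage9Params) (wOfRecord₉ F N θ.toStage9Params) θ.ppSel P
        (gOfRecord₁₀ F N θ.toStage9Params P) (k P)) s V ∂(fieldMeasure (F.P P.K) (k P + 1) (SU N)))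
    (hdeg : ∀ P : B12.RunParams, P.K ≤ k P →
      (repDataOfSel (repTOfRecord9 F N θ.ν θ.τ9 (EOfRecord₁₀ F N θ.toStage9Params) (wOfRecord₉ F N θ.toStage9Params) θ.ppSel P
          (gOfRecord₁₀ F N θ.toStage9Params P) (k P))
        (θ.ppSel P (gOfRecord₁₀ F N θ.toStage9Params P) (k P + 1)) (fibOfSeq F θ.ν θ.τ9 P (gOfRecord₁₀ F N θ.toStage9Params P) (k P + 1))).ProvisosSupp) :
    ∃ (σ : ∀ P : B12.RunParams, Sit189 F N P.K) (lamW : ResidW F N) (w : WorldP), lamW.kSel = k ∧ lamW.LF = L ∧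
      lamW.pinD189 θ.toStage9Params σ = lamW ∧ lamW.pinRPrime θ.toStage9Params = lamW ∧
      IsRecordOfRecord₁₂CB10YZW F N (datumOfRecord₁₂ F N θ h) w ∧ w.γ = γw ∧
      (∀ P, w.up P = upOfRecord₅C F N (θ.view₁₂B10YZW F N Mstar ops ζ lamW) P) ∧ ∀ P : B12.RunParams, Dag.B15_main (leavesP w P) := by
  obtain ⟨σ, hσ⟩ := exists_sit189_not_new189 N F
  obtain ⟨lam, hk, hLF, -⟩ := exists_residW_pinLF_printedDisplays θ.toStage9Params k L
  subst hk hLF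
  obtain ⟨w₀⟩ := nonempty_worldP
  refine ⟨σ, (lam.pinRPrime θ.toStage9Params).pinD189 θ.toStage9Params σ, { w₀ with
      C := (datumOfRecord₁₂ F N θ h).C, γ := γw, L := (θ.L : ℝ), one_lt_L := by exact_mod_cast θ.hL.2,
      up := fun P => upOfRecord₅C F N (θ.view₁₂B10YZW F N Mstar ops ζ ((lam.pinRPrime θ.toStage9Params).pinD189 θ.toStage9Params σ)) P },
    rfl, rfl, rfl, rfl,
    ⟨θ, h, Mstar, ops, ζ, (lam.pinRPrime θ.toStage9Params).pinD189 θ.toStage9Params σ, hθ, rfl, rfl, hγw, rfl, fun _ => rfl⟩, rfl, fun _ => rfl, fun P => ?_⟩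
  refine b15_main_of_up_view₁₂B10YZW_of_displays θ Mstar ops ζ ((lam.pinRPrime θ.toStage9Params).pinD189 θ.toStage9Params σ) rfl ?_
  exact wDisplays₁₀_pinAll_of_deg_of_not_new189 σ (hσ θ.toStage9Params) h.base (hdeg P) (hmass P) (hL P)

variable {D : Datum F N} {w : WorldP}

/-- **EVERY ₁₂C RECORD IS RE-PRESENTED BY A ₁₂CB10YZW WORLD WITH N06 AND N12 AT EVERY RUN WHOSE [IV] LAYER HAS ALL THREE LETTERS PINNED** (same `D`, construction, window,
block size; floor `0`, the N06 seat's zero operator layer, any [B11] layer; the layer of `exists_world₁₂CB10YZW_b15_main_pinAll_of_mass` at the presenting parameter).  The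
shape a K1′ ∃-assembly consumes for N06 ∧ N12 once it pins the [IV] letters: per presenting `(θ, h)` it owes `hmass ∕ hdeg` (NODE 00), `hL` (Proposition 1 at its carrier),
`h180`, `h189` (at the letters of record).  LOCATED; NOT-A-DISCHARGE. [cite: Balaban1989LargeFieldI, (0.2)–(0.6) p.176, Prop. 1 (1.78) p.194, (1.80) p.195, (1.89) p.198, (1.99)–(1.102) pp.200–201; Balaban1985BackgroundPropagators, Thms 3.1–3.15 pp.397–432; Balaban1989LargeFieldII, Thm 1 + (0.1) pp.355–356 (bookkeeping)] -/
theorem exists_rebind₁₂CB10YZW_b9_b15_main_pinAll_of_isRecordOfRecord₁₂C_of_mass (hrec : IsRecordOfRecord₁₂C F N D w) (k : B12.RunParams → ℕ)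
    (L : B12.RunParams → LFVar) (σ : ∀ P : B12.RunParams, Sit189 F N P.K) (hL : ∀ P, Prop1Printed (L P))
    (hyp : ∀ (θ : Stage12Params F N) (hP : θ.Provisos₁₂ F N), θ.Admissible F N → D = datumOfRecord₁₂ F N θ hP →
      (∀ P, w.up P = upOfRecord₅C F N (θ.toStage5₁₂ F N) P) →
        (∀ (P : B12.RunParams) s,
          0 < ∫ V, rterm (repTOfRecord9 F N θ.ν θ.τ9 (EOfRecord₁₀ F N θ.toStage9Params) (wOfRecord₉ F N θ.toStage9Params) θ.ppSel P
            (gOfRecord₁₀ F N θ.toStage9Params P) (k P)) s V ∂(fieldMeasure (F.P P.K) (k P + 1) (SU N))) ∧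
        (∀ P : B12.RunParams, P.K ≤ k P →
          (repDataOfSel (repTOfRecord9 F N θ.ν θ.τ9 (EOfRecord₁₀ F N θ.toStage9Params) (wOfRecord₉ F N θ.toStage9Params) θ.ppSel P
              (gOfRecord₁₀ F N θ.toStage9Params P) (k P))
            (θ.ppSel P (gOfRecord₁₀ F N θ.toStage9Params P) (k P + 1)) (fibOfSeq F θ.ν θ.τ9 P (gOfRecord₁₀ F N θ.toStage9Params P) (k P + 1))).ProvisosSupp) ∧
        (∀ (P : B12.RunParams) U, new189 (D189OfRecord θ.toStage9Params P (σ P)) U → ∀ i, (σ P).h ≤ i → i ≤ (σ P).k →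
          ∀ q ∈ plaqsOf (dom (D189OfRecord θ.toStage9Params P (σ P)) i),
            Ineq180 ((σ P).dev0 U.1 q) (epsOfRecord θ.ν (gOfRecord₁₀ F N θ.toStage9Params P) (σ P).k) ((F.P P.K).eta (σ P).k) (σ P).B₃ (σ P).B₅ (σ P).M
              (σ P).δ ((σ P).dist q) (σ P).O1) ∧
        (∀ P : B12.RunParams, Claim189 (new189 (D189OfRecord θ.toStage9Params P (σ P))) (chiPP (D189OfRecord θ.toStage9Params P (σ P))))) :
    ∃ w' : WorldP, IsRecordOfRecord₁₂CB10YZW F N D w' ∧ w'.C = w.C ∧ w'.γ = w.γ ∧ w'.L = w.L ∧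
      (∃ (θ : Stage12Params F N) (Mstar : ℕ) (ops : OpsY N θ.toStage3Params Mstar) (ζ : ResidZ F N) (lamW : ResidW F N),
        lamW.kSel = k ∧ lamW.LF = L ∧ lamW.pinD189 θ.toStage9Params σ = lamW ∧ lamW.pinRPrime θ.toStage9Params = lamW ∧
        ∀ P, w'.up P = upOfRecord₅C F N (θ.view₁₂B10YZW F N Mstar ops ζ lamW) P) ∧
      ∀ P : B12.RunParams, Dag.B9_main (leavesP w' P) ∧ Dag.B15_main (leavesP w' P) := by
  obtain ⟨θ, hP, hθ, hD, hCw, hγ, hwL, hup⟩ := hrec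
  obtain ⟨hm', hdeg, h180, h189⟩ := hyp θ hP hθ hD hup
  obtain ⟨lam, hk, hLF, -⟩ := exists_residW_pinLF_printedDisplays θ.toStage9Params k L
  subst hk hLF
  obtain ⟨ops, -, hleaf⟩ := exists_junkOps_b9LeafX_Y9OfRecord (N := N) θ.toStage3Params hθ.1.1.1.1.1 0
  obtain ⟨ζ⟩ := nonempty_residZ F N
  refine ⟨{ w with up := fun P => upOfRecord₅C F N (θ.view₁₂B10YZW F N 0 ops ζ ((lam.pinRPrime θ.toStage9Params).pinD189 θ.toStage9Params σ)) P },
    ⟨θ, hP, 0, ops, ζ, (lam.pinRPrime θ.toStage9Params).pinD189 θ.toStage9Params σ, hθ, hD, hCw, hγ, hwL, fun _ => rfl⟩, rfl, rfl, rfl,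
    ⟨θ, 0, ops, ζ, (lam.pinRPrime θ.toStage9Params).pinD189 θ.toStage9Params σ, rfl, rfl, rfl, rfl, fun _ => rfl⟩, fun P => ⟨?_, ?_⟩⟩
  · intro _ _ _ _
    show (upOfRecord₅C F N (θ.view₁₂B10YZW F N 0 ops ζ ((lam.pinRPrime θ.toStage9Params).pinD189 θ.toStage9Params σ)) P).b9
    exact (upOfRecord₅C_view₁₂B10YZW_leaves F N θ 0 ops ζ ((lam.pinRPrime θ.toStage9Params).pinD189 θ.toStage9Params σ) P).2.1.2 hleaf
  · refine b15_main_of_up_view₁₂B10YZW_of_displays θ 0 ops ζ ((lam.pinRPrime θ.toStage9Params).pinD189 θ.toStage9Params σ) rfl ?_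
    exact wDisplays₁₀_pinAll_of_deg σ hP.base (hdeg P) (hm' P) (hL P) (h180 P) (h189 P)

/-- **`S_N12 Rec` AT RECORDS WHOSE HIDDEN [IV] LAYERS ARE TRIPLY PINNED LAYERS, DEGENERATE-RUN FORM** — the ∀-form closer a K1′ assembly uses at any `Rec ⊆ ₁₂CB10YZW`
whose presenting packages' [IV] layers ARE `(λ₀.pinRPrime θ₉).pinD189 θ₉ σ` (the shape NODE 00's next [IV] pin would make definitional; the N12 s3 seat's Stage-11
`s_N12_of_refines₁₁CB10YZW_of_pinnedLayers_deg` one storey up, with the Proposition-1 carrier `λ₀.LF` left to the record): per `Rec`-pair, presenting package and run — the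
degenerate-run clause, positive mass, Proposition 1 on `λ₀.LF P`, (1.80) at `σ.dev0`, (1.89) at `D189OfRecord θ₉ P (σ P)` ⇒ `S_N12 Rec` (`N12AtRecord12CB10YZW.s_N12_of_refines₁₂CB10YZW_of_displays`
∘ `N12ResidWPinnedLayer.wDisplays₁₀_pinAll_of_deg`).  NOT-A-DISCHARGE. [cite: Balaban1989LargeFieldI, Prop. 1 (1.78) p.194, (0.2)–(0.6) p.176, (1.80) p.195, (1.89) p.198, (1.99)–(1.102) pp.200–201; Balaban1989LargeFieldII, Thm 1 + (0.1) pp.355–356 (bookkeeping)] -/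
theorem s_N12_of_refines₁₂CB10YZW_of_pinAll_deg (Rec : RecordPred N)
    (href : ∀ (F : T4Family) (D : Datum F N) (w : WorldP), Rec F D w → IsRecordOfRecord₁₂CB10YZW F N D w)
    (hyp : ∀ (F : T4Family) (D : Datum F N) (w : WorldP), Rec F D w →
      ∀ (θ : Stage12Params F N) (hP : θ.Provisos₁₂ F N) (Mstar : ℕ) (ops : OpsY N θ.toStage3Params Mstar) (ζ : ResidZ F N) (lamW : ResidW F N),
        θ.Admissible F N → D = datumOfRecord₁₂ F N θ hP → (∀ P, w.up P = upOfRecord₅C F N (θ.view₁₂B10YZW F N Mstar ops ζ lamW) P) →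
          ∃ (lam₀ : ResidW F N) (σ : ∀ P : B12.RunParams, Sit189 F N P.K),
            lamW = (lam₀.pinRPrime θ.toStage9Params).pinD189 θ.toStage9Params σ ∧ ∀ P : B12.RunParams,
              (P.K ≤ lam₀.kSel P →
                (repDataOfSel (repTOfRecord9 F N θ.ν θ.τ9 (EOfRecord₁₀ F N θ.toStage9Params) (wOfRecord₉ F N θ.toStage9Params) θ.ppSel P
                    (gOfRecord₁₀ F N θ.toStage9Params P) (lam₀.kSel P))
                  (θ.ppSel P (gOfRecord₁₀ F N θ.toStage9Params P) (lam₀.kSel P + 1))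
                  (fibOfSeq F θ.ν θ.τ9 P (gOfRecord₁₀ F N θ.toStage9Params P) (lam₀.kSel P + 1))).ProvisosSupp) ∧
              (∀ s, 0 < ∫ V, rterm (repTOfRecord9 F N θ.ν θ.τ9 (EOfRecord₁₀ F N θ.toStage9Params) (wOfRecord₉ F N θ.toStage9Params) θ.ppSel P
                (gOfRecord₁₀ F N θ.toStage9Params P) (lam₀.kSel P)) s V ∂(fieldMeasure (F.P P.K) (lam₀.kSel P + 1) (SU N))) ∧
              Prop1Printed (lam₀.LF P) ∧
              (∀ U, new189 (D189OfRecord θ.toStage9Params P (σ P)) U → ∀ i, (σ P).h ≤ i → i ≤ (σ P).k →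
                ∀ q ∈ plaqsOf (dom (D189OfRecord θ.toStage9Params P (σ P)) i),
                  Ineq180 ((σ P).dev0 U.1 q) (epsOfRecord θ.ν (gOfRecord₁₀ F N θ.toStage9Params P) (σ P).k) ((F.P P.K).eta (σ P).k) (σ P).B₃ (σ P).B₅ (σ P).M
                    (σ P).δ ((σ P).dist q) (σ P).O1) ∧
              Claim189 (new189 (D189OfRecord θ.toStage9Params P (σ P))) (chiPP (D189OfRecord θ.toStage9Params P (σ P)))) :
    S_N12 Rec :=
  s_N12_of_refines₁₂CB10YZW_of_displays Rec href (fun F D w hR θ hP Mstar ops ζ lamW hθ hD hup P => by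
    obtain ⟨lam₀, σ, hl, h⟩ := hyp F D w hR θ hP Mstar ops ζ lamW hθ hD hup
    obtain ⟨hdeg, hmass, hP1, h180, h189⟩ := h P
    rw [hl]
    exact wDisplays₁₀_pinAll_of_deg σ hP.base hdeg hmass hP1 h180 h189)

end AllPinned

end Summit.QuantumFields.YangMills.BalabanUVNodes.N12AtRecord12ExistsCurrency

end
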